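import Summits.ValiantsHypothesis.ValiantsHypothesis.Theorems.AnyonJetsPencilVNP0
import Summits.ValiantsHypothesis.ValiantsHypothesis.Theorems.AnyonJetsUniformJetUpperBoundStubJetTaylor
import Summits.ValiantsHypothesis.ValiantsHypothesis.Theorems.AnyonJetsJetConstantElimMultiplierRemovalCalibration
import Summits.ValiantsHypothesis.ValiantsHypothesis.Theorems.AnyonJetsJetConstantElimMultiplierRemovalInterpolation
import Literature.Computability.AlgebraicComplexity.BurgisserThm210Proofs
import HarnessLib

/-!
# AnyonJets — crux `JetConstantElim` (stmt-ValiantsHypothesis-16737), line `birth`, stub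
# `stub_multiplierRemoval`: the negation side carried out — if `PER` is constant-free easy, every
# anyonic jet is uniformly ULTIMATELY easy, so the stub and the sibling crux `CF` cannot both hold

The registered stub `stub_multiplierRemoval` (`MR`) of the line asserts that an integer multiplier
buys at most a `k`-independent polynomial on the jets `J_(n,k)`, `k ≤ log₂ n`
(`τ(J) ≤ (τ(M·J) + n + 2)^{b₃}`). Its docstring names the suspect that would kill it: a multiplier
`M = 2^{p(n)}` making `M·J_(n,k)` uniformly cheap (Koiran–Perifel 2011, Rem. 4 and Lemma 8–9;
Bürgisser 2009, Thm. 2.10 = tree `Burgisser2009_thm210_holds`). This file computes exactly what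
that mechanism gives, sorry-free:

* `cheapJetMultiples_of_twoPowPencilCheap` — INTEGRAL INTERPOLATION WITH A MULTIPLIER: if the
  `2^{p(n)}`-multiples of the inversion pencil `P_n(q; X) = Σ_σ q^{inv σ} x^σ` have constant-free
  cost `≤ n^a + a`, then for every `n` and EVERY `k` some multiple `M·J_(n,k)`, `M ≥ 1`
  (`M = det V · 2^{p(n)}`, `V` the integer Vandermonde matrix on the nodes `0, …, C(n,2)`), has
  `τ(M·J_(n,k)) ≤ (n+2)^{a+15}` — by `J_(n,k) = ± [u^k] P_n(u-1; X)` (tree `map_jet_eq_smul_coeff`),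
  Cramer's rule `det V · [u^k] G = Σ_i adj(V)_{k,i} G(i)` (no division), the substitution bound
  `τ(F(q := c)) ≤ τ(F) + τ(c)` and the constant-free determinant circuit for the integer constants
  `adj(V)_{k,i}` — toolkit in `AnyonJetsJetConstantElimMultiplierRemovalInterpolation.lean`.
* `cheapJetMultiples_of_perEasy` — with `(P_n) ∈ VNP⁰` (`isVNP0Family_pencil`,
  `AnyonJetsPencilVNP0.lean`) and Bürgisser's Thm. 2.10: `τ(PER_n) = n^{O(1)}` ⇒ uniformly cheap
  jet multiples ("every anyonic jet is ultimately easy, uniformly in `(n, k)`").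
* `not_multiplierRemoval_of_perEasy_of_cfGrowth` — hence (with the calibration file's
  `not_multiplierRemoval_of_cheapMultiples_of_cfGrowth`): `τ(PER) = n^{O(1)}` and the sibling crux
  `ConstantFreeJetGrowth` together REFUTE the stub (signature verbatim under `¬`); equivalently
  `not_isPBounded_tau_per_of_multiplierRemoval_of_cfGrowth`: the stub and `CF` jointly prove
  `τ(PER_n) ≠ n^{O(1)}` (Bürgisser's hypothesis), i.e. the open stub carries, with `CF`, the full
  "permanent is not constant-free easy" content — it is not a cheap residue of the crux.

What this says about the director's question ("does `M = 2^{p(n)}` make `M·J_(n,k)` uniformly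
cheap via the 2-adic shadow / Thm. 2.10?"): YES in, and only known in, a world where `PER` is
constant-free easy; unconditionally no cheap multiple of any jet is known, and the route's 2-adic
shadow `per − Σ_(j<k)(−2)^j J_j ∈ 2^k ℤ[x]` prices `2^k ×` the jet TAIL by `per`, the wrong way
round. Honest framing: conditional calibration of an OPEN conjecture-grade stub; neither the
stub nor its negation is proved; `JetConstantElim` stays open; VP ≠ VNP is NOT proved here.

References: P. Bürgisser, *On defining integers and proving arithmetic circuit lower bounds*,
Comput. Complexity 18 (2009), Thm. 2.10; P. Koiran, S. Perifel, *Interpolation in Valiant's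
theory*, Comput. Complexity 20 (2011), Rem. 4, Lemma 8–9 (arXiv:0710.0360 p. 8–9); P. Koiran,
*Valiant's model and the cost of computing integers*, Comput. Complexity 13 (2004), Thm. 4.3;
V. Strassen, *Vermeidung von Divisionen*, Crelle 264 (1973) (interpolation of coefficients).
-/

noncomputable section

-- single-conjunct layout: Sub = Summit, duplicated namespace component intended
set_option linter.dupNamespace false

namespace Summit.ValiantsHypothesis.ValiantsHypothesis.Theorems.AnyonJets.JetConstantElim

open MvPolynomial Literature.Computability.AlgebraicComplexity Finset
open Summit.ValiantsHypothesis.ValiantsHypothesis.Theses.AnyonJets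
open Summit.ValiantsHypothesis.ValiantsHypothesis.Theorems.AnyonJets.ConstantFreeJetGrowth (jet)
open Summit.ValiantsHypothesis.ValiantsHypothesis.Theorems.AnyonJets.UniformJet

/-! ### Every jet has a uniformly cheap multiple if the `2^p`-multiples of the pencil are cheap -/

section Jets

variable (n : ℕ)

/-- **Integral interpolation with a multiplier** (the technical heart): if the `2^{p(n)}`-multiples
of the inversion pencil `P_n(q; X) = Σ_σ q^{inv σ} Πᵢ X_{σ i, i}` have constant-free cost
`≤ n^a + a`, then EVERY jet `J_(n,k)` has a multiple `M·J_(n,k)`, `M = det V · 2^{p(n)} ≥ 1`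
(`V` = integer Vandermonde on the nodes `0, …, C(n,2)`), with `τ(M·J_(n,k)) ≤ (n+2)^{a+15}`:
`M·J_(n,k) = ± Σ_{i ≤ C(n,2)} adj(V)_{k,i} · (2^{p(n)} P_n)(i - 1; X)`, a sum of `C(n,2)+1`
specialisations times cheap integer constants. [folklore] -/
theorem cheapJetMultiples_of_twoPowPencilCheap (p : ℕ → ℕ) (a : ℕ)
    (hF : ∀ n : ℕ, constantFreeComplexity (C ((2 : ℤ) ^ p n) * ∑ σ : Equiv.Perm (Fin n),
        (X none : MvPolynomial (Option (Fin n × Fin n)) ℤ) ^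
            (univ.filter (fun q : Fin n × Fin n => q.1 < q.2 ∧ σ q.2 < σ q.1)).card *
          ∏ i : Fin n, X (some (σ i, i))) ≤ n ^ a + a) :
    ∃ c : ℕ, ∀ n k : ℕ, ∃ M : ℕ, 1 ≤ M ∧
      constantFreeComplexity ((M : ℤ) • jet n k) ≤ (n + 2) ^ c := by
  refine ⟨a + 15, fun n k => ?_⟩
  -- the shifted pencil as a polynomial in `u`, its degree, and the jet as a coefficient
  set G := optionEquivLeft ℤ (Fin n × Fin n) (∑ σ : Equiv.Perm (Fin n),
      ((X none : MvPolynomial (Option (Fin n × Fin n)) ℤ) - 1) ^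
          (univ.filter (fun q : Fin n × Fin n => q.1 < q.2 ∧ σ q.2 < σ q.1)).card *
        ∏ i : Fin n, X (some (σ i, i))) with hG
  set m := n * (n - 1) / 2 + 1 with hm
  have hdeg : G.natDegree < m := Nat.lt_succ_of_le (natDegree_shiftedPencil_le ℤ n)
  have hjet : jet n k = (-1 : ℤ) ^ k • G.coeff k := by
    have h := map_jet_eq_smul_coeff ℤ n k
    rw [Int.castRingHom_int, MvPolynomial.map_id] at h
    exact h
  have hX2 : 2 ≤ n + 2 := by omega
  by_cases hk : k < m
  swap
  · -- beyond the degree the jet vanishes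
    refine ⟨1, le_rfl, ?_⟩
    have h0 : G.coeff k = 0 := Polynomial.coeff_eq_zero_of_natDegree_lt (by omega)
    rw [hjet, h0, smul_zero, smul_zero, constantFreeComplexity_zero]
    exact Nat.zero_le _
  -- the Vandermonde multiplier
  set V := Matrix.vandermonde (fun i : Fin m => (i : ℤ)) with hV
  have hDpos : 0 < V.det := det_vandermonde_nat_pos m
  set κ : Fin m := ⟨k, hk⟩ with hκ
  refine ⟨V.det.toNat * 2 ^ p n, ?_, ?_⟩
  · have : 0 < V.det.toNat := by omega
    exact Nat.mul_pos this (pow_pos (by norm_num) _)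
  -- the specialised multiples and the identity `M·J = Σ_i C(± adj_{k,i}) · (2^p P_n)(i-1; X)`
  set F := C ((2 : ℤ) ^ p n) * ∑ σ : Equiv.Perm (Fin n),
      (X none : MvPolynomial (Option (Fin n × Fin n)) ℤ) ^
          (univ.filter (fun q : Fin n × Fin n => q.1 < q.2 ∧ σ q.2 < σ q.1)).card *
        ∏ i : Fin n, X (some (σ i, i)) with hFdef
  have hId : ((V.det.toNat * 2 ^ p n : ℕ) : ℤ) • jet n k =
      ∑ i : Fin m, C ((-1) ^ k * V.adjugate κ i) *
        aeval (fun o : Option (Fin n × Fin n) => o.elim (C ((i : ℤ) - 1)) X) F := by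
    have hA := det_vandermonde_mul_coeff_eq_sum G hdeg κ
    have hcast : ((V.det.toNat * 2 ^ p n : ℕ) : ℤ) = 2 ^ p n * V.det := by
      push_cast
      rw [Int.toNat_of_nonneg hDpos.le]
      ring
    have hterm : ∀ i : Fin m, C ((-1) ^ k * V.adjugate κ i) *
        aeval (fun o : Option (Fin n × Fin n) => o.elim (C ((i : ℤ) - 1)) X) F =
          C ((-1 : ℤ) ^ k * 2 ^ p n) * ((V.adjugate κ i : MvPolynomial (Fin n × Fin n) ℤ) *
            G.eval ((i : ℕ) : MvPolynomial (Fin n × Fin n) ℤ)) := by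
      intro i
      rw [hFdef, aeval_elim_twoPowPencil, ← hG]
      have e1 : (C (i : ℤ) : MvPolynomial (Fin n × Fin n) ℤ) = ((i : ℕ) : MvPolynomial (Fin n × Fin n) ℤ) :=
        map_natCast C i
      rw [e1]
      simp only [map_mul, eq_intCast]
      ring
    rw [Finset.sum_congr rfl fun i _ => hterm i, ← Finset.mul_sum, ← hA, hcast, hjet, smul_smul,
      MvPolynomial.smul_eq_C_mul]
    have hκk : ((κ : ℕ)) = k := rfl
    rw [hκk]
    simp only [map_mul, eq_intCast]
    ring
  rw [hId]
  -- cost of one term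
  have hmX : m + 1 ≤ (n + 2) ^ 2 := nodes_le_sq n
  have hterm : ∀ i : Fin m, constantFreeComplexity (C ((-1) ^ k * V.adjugate κ i) *
      aeval (fun o : Option (Fin n × Fin n) => o.elim (C ((i : ℤ) - 1)) X) F) ≤
        18 * (n + 2) ^ (a + 8) + 1 := by
    intro i
    refine (constantFreeComplexity_mul_le _ _).trans (Nat.add_le_add_right ?_ 1)
    have h1 : constantFreeComplexity (C ((-1) ^ k * V.adjugate κ i) :
        MvPolynomial (Fin n × Fin n) ℤ) ≤ 4 * (m + 1) ^ 4 + m * m * (5 * m + 2) + 1 :=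
      (constantFreeComplexity_C_neg_one_pow_mul_le k _).trans
        (Nat.add_le_add_right (constantFreeComplexity_C_adjugate_vandermonde_le m κ i) 1)
    have h2 : constantFreeComplexity
        (aeval (fun o : Option (Fin n × Fin n) => o.elim (C ((i : ℤ) - 1)) X) F) ≤
          n ^ a + a + (3 * m + 1) := by
      refine (constantFreeComplexity_aeval_elim_le F _).trans (Nat.add_le_add (hF n) ?_)
      refine (constantFreeComplexity_C_intCast_le_log _).trans ?_
      have habs : (((i : ℕ) : ℤ) - 1).natAbs ≤ (i : ℕ) + 1 := by omega
      have hlog : Nat.log 2 ((((i : ℕ) : ℤ) - 1).natAbs) ≤ m :=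
        (Nat.log_le_self 2 _).trans (habs.trans (Nat.succ_le_of_lt i.isLt))
      omega
    -- everything in powers of `X = n + 2`
    have hXa1 : n ^ a ≤ (n + 2) ^ a := Nat.pow_le_pow_left (by omega) _
    have hXa2 : a ≤ (n + 2) ^ a := le_trans (Nat.lt_two_pow_self).le (Nat.pow_le_pow_left hX2 _)
    have hm1 : (m + 1) ^ 4 ≤ (n + 2) ^ 8 := by
      calc (m + 1) ^ 4 ≤ ((n + 2) ^ 2) ^ 4 := Nat.pow_le_pow_left hmX 4
        _ = (n + 2) ^ 8 := by rw [← pow_mul]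
    have hm2 : m * m ≤ (n + 2) ^ 4 := by
      calc m * m ≤ (n + 2) ^ 2 * (n + 2) ^ 2 := Nat.mul_le_mul (by omega) (by omega)
        _ = (n + 2) ^ 4 := by rw [← pow_add]
    have hm3 : 5 * m + 2 ≤ 6 * (n + 2) ^ 2 := by nlinarith
    have hm4 : m * m * (5 * m + 2) ≤ 6 * (n + 2) ^ 8 := by
      calc m * m * (5 * m + 2) ≤ (n + 2) ^ 4 * (6 * (n + 2) ^ 2) := Nat.mul_le_mul hm2 hm3
        _ = 6 * ((n + 2) ^ 4 * (n + 2) ^ 2) := by ring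
        _ ≤ 6 * ((n + 2) ^ 4 * (n + 2) ^ 4) :=
            Nat.mul_le_mul_left _ (Nat.mul_le_mul_left _ (Nat.pow_le_pow_right (by omega) (by omega)))
        _ = 6 * (n + 2) ^ 8 := by rw [← pow_add]
    have hm5 : 3 * m + 1 ≤ 4 * (n + 2) ^ 8 := by
      have : (n + 2) ^ 2 ≤ (n + 2) ^ 8 := Nat.pow_le_pow_right (by omega) (by omega)
      omega
    have hp1 : (n + 2) ^ a ≤ (n + 2) ^ (a + 8) := Nat.pow_le_pow_right (by omega) (by omega)
    have hp2 : (n + 2) ^ 8 ≤ (n + 2) ^ (a + 8) := Nat.pow_le_pow_right (by omega) (by omega)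
    omega
  -- sum of the `m` terms
  refine (constantFreeComplexity_finset_sum_le _ _).trans ?_
  rw [Finset.card_univ, Fintype.card_fin]
  have hsum : ∑ i : Fin m, constantFreeComplexity (C ((-1) ^ k * V.adjugate κ i) *
      aeval (fun o : Option (Fin n × Fin n) => o.elim (C ((i : ℤ) - 1)) X) F) ≤
        m * (18 * (n + 2) ^ (a + 8) + 1) := by
    refine (Finset.sum_le_sum fun i _ => hterm i).trans ?_
    rw [Finset.sum_const, Finset.card_univ, Fintype.card_fin, smul_eq_mul]
  have hm0 : m ≤ (n + 2) ^ 2 := by omega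
  have hfin : m * (18 * (n + 2) ^ (a + 8) + 1) + m ≤ 20 * (n + 2) ^ (a + 10) := by
    have e : (n + 2) ^ (a + 10) = (n + 2) ^ 2 * (n + 2) ^ (a + 8) := by rw [← pow_add]; ring_nf
    have h1 : 1 ≤ (n + 2) ^ (a + 8) := Nat.one_le_pow _ _ (by omega)
    rw [e]
    nlinarith
  have h20 : 20 * (n + 2) ^ (a + 10) ≤ (n + 2) ^ (a + 15) := by
    have h5 : 20 ≤ (n + 2) ^ 5 := le_trans (by norm_num) (Nat.pow_le_pow_left hX2 5)
    calc 20 * (n + 2) ^ (a + 10) ≤ (n + 2) ^ 5 * (n + 2) ^ (a + 10) := Nat.mul_le_mul_right _ h5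
      _ = (n + 2) ^ (a + 15) := by rw [← pow_add]; ring_nf
  omega

end Jets

/-! ### Conclusion: `τ(PER) = n^{O(1)}` makes the jets uniformly ultimately easy, so it is
incompatible with `stub_multiplierRemoval ∧ ConstantFreeJetGrowth` -/

/-- **If the permanent is constant-free easy, every anyonic jet is ultimately easy, uniformly**:
`τ(PER_n) = n^{O(1)} ⟹ ∃ c ∀ n ∀ k ∃ M ≥ 1, τ(M·J_(n,k)) ≤ (n+2)^c` — Bürgisser 2009 Thm. 2.10
(`Burgisser2009_thm210_holds`) applied to the `VNP⁰` family `(P_n)` (`isVNP0Family_pencil`) gives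
`τ(2^{p(n)} P_n) = n^{O(1)}`, and integral interpolation (`cheapJetMultiples_of_twoPowPencilCheap`)
extracts the jets with the further multiplier `det V`. [cite: Burgisser2009, Thm. 2.10] -/
theorem cheapJetMultiples_of_perEasy
    (hper : IsPBounded fun n => constantFreeComplexity (perPoly (Fin n) ℤ)) :
    ∃ c : ℕ, ∀ n k : ℕ, ∃ M : ℕ, 1 ≤ M ∧
      constantFreeComplexity ((M : ℤ) • jet n k) ≤ (n + 2) ^ c := by
  obtain ⟨p, -, a, ha⟩ := Burgisser2009_thm210_holds hper (fun n => Option (Fin n × Fin n)) _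
    isVNP0Family_pencil
  exact cheapJetMultiples_of_twoPowPencilCheap p a ha

/-- **The suspect named by the stub's docstring, made precise**: `τ(PER_n) = n^{O(1)}` together
with the sibling crux `ConstantFreeJetGrowth` REFUTES `stub_multiplierRemoval` (signature verbatim
under `¬`): the `2^{p(n)}`-type multipliers of Koiran–Perifel 2011 Rem. 4 / Bürgisser 2009
Thm. 2.10 make every jet uniformly ultimately easy, `MR` would make the jets uniformly easy
outright, and that contradicts `CF` (`not_multiplierRemoval_of_cheapMultiples_of_cfGrowth`).
Unconditionally no such multiplier is known. [cite: KoiranPerifel2011, Rem. 4] -/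
theorem not_multiplierRemoval_of_perEasy_of_cfGrowth
    (hper : IsPBounded fun n => constantFreeComplexity (perPoly (Fin n) ℤ))
    (hCF : ConstantFreeJetGrowth) :
    ¬ (let J := fun (n k : ℕ) => (∑ σ : Equiv.Perm (Fin n), MvPolynomial.C (((Equiv.Perm.sign σ : ℤˣ) : ℤ) * (((Finset.univ.filter (fun p : Fin n × Fin n => p.1 < p.2 ∧ σ p.2 < σ p.1)).card.choose k : ℕ) : ℤ)) * ∏ i : Fin n, MvPolynomial.X (σ i, i) : MvPolynomial (Fin n × Fin n) ℤ);
      ∃ b₃ : ℕ, ∀ n k M : ℕ, k ≤ Nat.log 2 n → 1 ≤ M →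
        Literature.Computability.AlgebraicComplexity.constantFreeComplexity (J n k) ≤
          (Literature.Computability.AlgebraicComplexity.constantFreeComplexity ((M : ℤ) • J n k) + n + 2) ^ b₃) := by
  obtain ⟨c, hc⟩ := cheapJetMultiples_of_perEasy hper
  exact not_multiplierRemoval_of_cheapMultiples_of_cfGrowth ⟨c, fun n k _ => hc n k⟩ hCF

/-- **Calibration, positive reading**: the stub `stub_multiplierRemoval` and the sibling crux
`ConstantFreeJetGrowth` jointly prove Bürgisser's hypothesis "`τ(PER_n)` is not polynomially
bounded" (the permanent is not constant-free easy) — so the open stub is, with `CF`, at least as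
strong as `PER ∉ VP⁰`-type statements; it is not a cheap residue of the crux. [cite: Burgisser2009, Thm. 2.10] -/
theorem not_isPBounded_tau_per_of_multiplierRemoval_of_cfGrowth
    (hR : let J := fun (n k : ℕ) => (∑ σ : Equiv.Perm (Fin n), MvPolynomial.C (((Equiv.Perm.sign σ : ℤˣ) : ℤ) * (((Finset.univ.filter (fun p : Fin n × Fin n => p.1 < p.2 ∧ σ p.2 < σ p.1)).card.choose k : ℕ) : ℤ)) * ∏ i : Fin n, MvPolynomial.X (σ i, i) : MvPolynomial (Fin n × Fin n) ℤ);
      ∃ b₃ : ℕ, ∀ n k M : ℕ, k ≤ Nat.log 2 n → 1 ≤ M →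
        Literature.Computability.AlgebraicComplexity.constantFreeComplexity (J n k) ≤
          (Literature.Computability.AlgebraicComplexity.constantFreeComplexity ((M : ℤ) • J n k) + n + 2) ^ b₃)
    (hCF : ConstantFreeJetGrowth) :
    ¬ IsPBounded fun n => constantFreeComplexity (perPoly (Fin n) ℤ) :=
  fun hper => not_multiplierRemoval_of_perEasy_of_cfGrowth hper hCF hR

end Summit.ValiantsHypothesis.ValiantsHypothesis.Theorems.AnyonJets.JetConstantElim

end
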